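import Mathlib
import Summits.Ventures.PercRepro2.UniversalTheta

/-! # (UH*) for `X` in series with a MULTI-TOP theta-structured network
(seat mine-b, cell pub-perc-repro2; MINE-B.md §23)

`ThetaData` (UniversalThetaCert.lean) has a single top `(0,2)`.  The configuration cube of `Y₁ ∗ Y₂` for two
flow-1 series–parallel terms `Y_i` has in general MANY `(0,2)`-elements (`(e ∗ e) ∧ e` has flow 1 and three
all-blue-flow states), so the single-top structure does not reach every network of max flow ≤ 2.  The relay
certificate does not care: **`ThetaData2`** asks for labels with `ρ + β ≤ 2` and, for EVERY top `t` (label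
`(0,2)`), a private triple `y00 t (2,0)`, `yA t (1,1)`, `yB t (1,1)` below `t` — the three maps injective on the
tops, the `yA`- and `yB`-images disjoint — plus the injective relay `τ` of the `(0,1)`-elements to `(1,0)`-elements
below them.  The certificate is the B₂ one fibre by fibre (`G_1` on every `y00`-image at level 1, `V2_2` on every
`yB`-image at level 2, the level-1 Harris weight on every `(1,1)`-fibre and every `τ`-image, the containments
top → its `y00` / `yA` / `yB` and `(0,1)`-fibre → its `τ`-image), so the pointwise lemmas `tcert_le_*` of
UniversalThetaCert.lean are reused verbatim; the sums use one injection lemma `t2sum_rel_ge` for all five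
containment rows.  **`universal_theta2`**: `X` carrying `G_1`, `V2_2` and the level-1 Harris inequality, in series
with any `ThetaData2`-structured `Y`, satisfies (UH*).  UniversalFlow2.lean builds the `ThetaData2` of `Y₁ ∗ Y₂`
from the level-1 Harris assignments of the parts. -/

namespace Summit.Ventures.PercRepro2.UHClosure

open Finset

variable {X : Type*} [Preorder X] [Fintype X] {Y : Type*} [Preorder Y] [Fintype Y] [DecidableEq Y]

/-- the multi-top theta structure on a labelled poset `Y` -/
structure ThetaData2 (ρ β : Y → ℕ) where
  /-- the labels: `ρ + β ≤ 2`, i.e. one of `(0,0), (0,1), (1,0), (1,1), (2,0), (0,2)` -/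
  hlab : ∀ y, ρ y + β y ≤ 2
  /-- the `(2,0)`-element attached to a top -/
  y00 : Y → Y
  /-- the first `(1,1)`-element attached to a top -/
  yA : Y → Y
  /-- the second `(1,1)`-element attached to a top -/
  yB : Y → Y
  /-- the relay of the `(0,1)`-elements to `(1,0)`-elements below them -/
  τ : Y → Y
  h00 : ∀ t, ρ t = 0 → β t = 2 → y00 t ≤ t ∧ ρ (y00 t) = 2 ∧ β (y00 t) = 0
  hA : ∀ t, ρ t = 0 → β t = 2 → yA t ≤ t ∧ ρ (yA t) = 1 ∧ β (yA t) = 1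
  hB : ∀ t, ρ t = 0 → β t = 2 → yB t ≤ t ∧ ρ (yB t) = 1 ∧ β (yB t) = 1
  h00inj : ∀ t t', ρ t = 0 → β t = 2 → ρ t' = 0 → β t' = 2 → y00 t = y00 t' → t = t'
  hAinj : ∀ t t', ρ t = 0 → β t = 2 → ρ t' = 0 → β t' = 2 → yA t = yA t' → t = t'
  hBinj : ∀ t t', ρ t = 0 → β t = 2 → ρ t' = 0 → β t' = 2 → yB t = yB t' → t = t'
  hAB : ∀ t t', ρ t = 0 → β t = 2 → ρ t' = 0 → β t' = 2 → yA t ≠ yB t'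
  hτ : ∀ y, ρ y = 0 → β y = 1 → τ y ≤ y ∧ ρ (τ y) = 1 ∧ β (τ y) = 0
  hτinj : ∀ y y', ρ y = 0 → β y = 1 → ρ y' = 0 → β y' = 1 → τ y = τ y' → y = y'

variable (r b : X → ℕ) (ρ β : Y → ℕ)

section roles

/-- `y` is a top: label `(0,2)` -/
def isTop (y : Y) : Prop := ρ y = 0 ∧ β y = 2

/-- decidable -/
instance (y : Y) : Decidable (isTop ρ β y) := inferInstanceAs (Decidable (ρ y = 0 ∧ β y = 2))

variable (D : ThetaData2 ρ β)

/-- `y` is the `y00` of a top -/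
def isY00 (y : Y) : Prop := ∃ t, isTop ρ β t ∧ D.y00 t = y

/-- decidable by finiteness -/
instance (y : Y) : Decidable (isY00 ρ β D y) := by unfold isY00; infer_instance

/-- `y` is the `yA` of a top -/
def isYA (y : Y) : Prop := ∃ t, isTop ρ β t ∧ D.yA t = y

/-- decidable by finiteness -/
instance (y : Y) : Decidable (isYA ρ β D y) := by unfold isYA; infer_instance

/-- `y` is the `yB` of a top -/
def isYB (y : Y) : Prop := ∃ t, isTop ρ β t ∧ D.yB t = y

/-- decidable by finiteness -/
instance (y : Y) : Decidable (isYB ρ β D y) := by unfold isYB; infer_instance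

/-- `y` is the `τ`-image of a `(0,1)`-element -/
def isImg2 (y : Y) : Prop := ∃ y', is01 ρ β y' ∧ D.τ y' = y

/-- decidable by finiteness -/
instance (y : Y) : Decidable (isImg2 ρ β D y) := by unfold isImg2; infer_instance

omit [Fintype Y] [DecidableEq Y] in
/-- the label of a `y00` -/
lemma lab_y00 {y : Y} (h : isY00 ρ β D y) : ρ y = 2 ∧ β y = 0 := by
  obtain ⟨t, ht, he⟩ := h
  have := D.h00 t ht.1 ht.2
  rw [he] at this
  exact this.2

omit [Fintype Y] [DecidableEq Y] in
/-- the label of a `yA` -/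
lemma lab_yA {y : Y} (h : isYA ρ β D y) : ρ y = 1 ∧ β y = 1 := by
  obtain ⟨t, ht, he⟩ := h
  have := D.hA t ht.1 ht.2
  rw [he] at this
  exact this.2

omit [Fintype Y] [DecidableEq Y] in
/-- the label of a `yB` -/
lemma lab_yB {y : Y} (h : isYB ρ β D y) : ρ y = 1 ∧ β y = 1 := by
  obtain ⟨t, ht, he⟩ := h
  have := D.hB t ht.1 ht.2
  rw [he] at this
  exact this.2

omit [Fintype Y] [DecidableEq Y] in
/-- the label of a `τ`-image -/
lemma lab_img2 {y : Y} (h : isImg2 ρ β D y) : ρ y = 1 ∧ β y = 0 := by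
  obtain ⟨y', hy', he⟩ := h
  have := D.hτ y' hy'.1 hy'.2
  rw [he] at this
  exact this.2

omit [Fintype Y] [DecidableEq Y] in
/-- a `yA` is never a `yB` -/
lemma yA_not_yB {y : Y} (h : isYA ρ β D y) : ¬ isYB ρ β D y := by
  rintro ⟨t', ht', he'⟩
  obtain ⟨t, ht, he⟩ := h
  exact D.hAB t t' ht.1 ht.2 ht'.1 ht'.2 (he.trans he'.symm)

end roles

/-! ### the certificate -/

section cert

variable (D : ThetaData2 ρ β)

/-- the statement part of the certificate -/
noncomputable def t2certS (a c : ℕ) (y : Y) (m : ℕ∞) : ℤ :=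
  (if isY00 ρ β D y ∧ m ≤ 1 then gw 1 a c else 0) + (if isYB ρ β D y ∧ m ≤ 2 then vw 2 a c else 0)
    + (if is11 ρ β y ∧ m ≤ 1 then hwOne a c else 0) + (if isImg2 ρ β D y ∧ m ≤ 1 then hwOne a c else 0)

/-- the containment part of the certificate -/
noncomputable def t2certC (a c : ℕ) (y : Y) (m : ℕ∞) : ℤ :=
  mu1 a c * (indL (isY00 ρ β D y ∧ m ≤ 1) - indL (isTop ρ β y ∧ m ≤ 1))
    + mu2 a c * (indL (isYB ρ β D y ∧ m ≤ 2) - indL (isTop ρ β y ∧ m ≤ 2))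
    + mu3 a c * (indL (isYA ρ β D y ∧ m ≤ 1) - indL (isTop ρ β y ∧ m ≤ 1))
    + mu4 a c * (indL (isYA ρ β D y ∧ m ≤ 2) + indL (isYB ρ β D y ∧ m ≤ 2) - 2 * indL (isTop ρ β y ∧ m ≤ 2))
    + mu01 c * (indL (isImg2 ρ β D y ∧ m ≤ 1) - indL (is01 ρ β y ∧ m ≤ 1))

/-- the certificate at a natural value equals the pattern form of UniversalThetaCert.lean -/
lemma t2cert_coe_eq (a c : ℕ) (y : Y) (n : ℕ) (bT b00 bA bB b11 bI b01 : Bool)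
    (hT : isTop ρ β y ↔ bT = true) (h00 : isY00 ρ β D y ↔ b00 = true) (hA : isYA ρ β D y ↔ bA = true)
    (hB : isYB ρ β D y ↔ bB = true) (h11 : is11 ρ β y ↔ b11 = true) (hI : isImg2 ρ β D y ↔ bI = true)
    (h01 : is01 ρ β y ↔ b01 = true) :
    t2certS ρ β D a c y (n : ℕ∞) + t2certC ρ β D a c y (n : ℕ∞) = tcert' a c bT b00 bA bB b11 bI b01 n := by
  have e1 : ((n : ℕ∞) ≤ 1) ↔ n ≤ 1 := by exact_mod_cast Iff.rfl
  have e2 : ((n : ℕ∞) ≤ 2) ↔ n ≤ 2 := by exact_mod_cast Iff.rfl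
  simp only [t2certS, t2certC, tcert', hT, h00, hA, hB, h11, hI, h01, e1, e2]

/-- the certificate vanishes at `⊤` -/
lemma t2cert_top (a c : ℕ) (y : Y) : t2certS ρ β D a c y ⊤ + t2certC ρ β D a c y ⊤ = 0 := by
  simp [t2certS, t2certC, indL]

omit [Preorder X] [Fintype X] in
/-- the pointwise certificate at natural values, for every fibre, by its role -/
lemma t2cert_le_fibre (a c : ℕ) (y : Y) (n : ℕ) :
    t2certS ρ β D a c y (n : ℕ∞) + t2certC ρ β D a c y (n : ℕ∞) ≤ tw' a c (ρ y) (β y) n := by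
  have hlab := D.hlab y
  by_cases hT : isTop ρ β y
  · have n00 : ¬ isY00 ρ β D y := fun h => by have := lab_y00 ρ β D h; unfold isTop at hT; omega
    have nA : ¬ isYA ρ β D y := fun h => by have := lab_yA ρ β D h; unfold isTop at hT; omega
    have nB : ¬ isYB ρ β D y := fun h => by have := lab_yB ρ β D h; unfold isTop at hT; omega
    have n11 : ¬ is11 ρ β y := fun h => by unfold is11 at h; unfold isTop at hT; omega
    have nI : ¬ isImg2 ρ β D y := fun h => by have := lab_img2 ρ β D h; unfold isTop at hT; omega
    have n01 : ¬ is01 ρ β y := fun h => by unfold is01 at h; unfold isTop at hT; omega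
    rw [t2cert_coe_eq ρ β D a c y n true false false false false false false (iff_of_true hT rfl)
      (iff_of_false n00 (by decide)) (iff_of_false nA (by decide)) (iff_of_false nB (by decide))
      (iff_of_false n11 (by decide)) (iff_of_false nI (by decide)) (iff_of_false n01 (by decide)), hT.1, hT.2]
    exact tcert_le_top a c n
  by_cases h00 : isY00 ρ β D y
  · have hl := lab_y00 ρ β D h00
    have nA : ¬ isYA ρ β D y := fun h => by have := lab_yA ρ β D h; omega
    have nB : ¬ isYB ρ β D y := fun h => by have := lab_yB ρ β D h; omega
    have n11 : ¬ is11 ρ β y := fun h => by unfold is11 at h; omega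
    have nI : ¬ isImg2 ρ β D y := fun h => by have := lab_img2 ρ β D h; omega
    have n01 : ¬ is01 ρ β y := fun h => by unfold is01 at h; omega
    rw [t2cert_coe_eq ρ β D a c y n false true false false false false false (iff_of_false hT (by decide))
      (iff_of_true h00 rfl) (iff_of_false nA (by decide)) (iff_of_false nB (by decide))
      (iff_of_false n11 (by decide)) (iff_of_false nI (by decide)) (iff_of_false n01 (by decide)), hl.1, hl.2]
    exact tcert_le_y00 a c n
  by_cases hA : isYA ρ β D y
  · have hl := lab_yA ρ β D hA
    have nB : ¬ isYB ρ β D y := yA_not_yB ρ β D hA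
    have i11 : is11 ρ β y := ⟨hl.1, hl.2⟩
    have nI : ¬ isImg2 ρ β D y := fun h => by have := lab_img2 ρ β D h; omega
    have n01 : ¬ is01 ρ β y := fun h => by unfold is01 at h; omega
    rw [t2cert_coe_eq ρ β D a c y n false false true false true false false (iff_of_false hT (by decide))
      (iff_of_false h00 (by decide)) (iff_of_true hA rfl) (iff_of_false nB (by decide))
      (iff_of_true i11 rfl) (iff_of_false nI (by decide)) (iff_of_false n01 (by decide)), hl.1, hl.2]
    exact tcert_le_yA a c n
  by_cases hB : isYB ρ β D y
  · have hl := lab_yB ρ β D hB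
    have i11 : is11 ρ β y := ⟨hl.1, hl.2⟩
    have nI : ¬ isImg2 ρ β D y := fun h => by have := lab_img2 ρ β D h; omega
    have n01 : ¬ is01 ρ β y := fun h => by unfold is01 at h; omega
    rw [t2cert_coe_eq ρ β D a c y n false false false true true false false (iff_of_false hT (by decide))
      (iff_of_false h00 (by decide)) (iff_of_false hA (by decide)) (iff_of_true hB rfl)
      (iff_of_true i11 rfl) (iff_of_false nI (by decide)) (iff_of_false n01 (by decide)), hl.1, hl.2]
    exact tcert_le_yB a c n
  by_cases h11 : is11 ρ β y
  · have nI : ¬ isImg2 ρ β D y := fun h => by have := lab_img2 ρ β D h; unfold is11 at h11; omega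
    have n01 : ¬ is01 ρ β y := fun h => by unfold is01 at h; unfold is11 at h11; omega
    rw [t2cert_coe_eq ρ β D a c y n false false false false true false false (iff_of_false hT (by decide))
      (iff_of_false h00 (by decide)) (iff_of_false hA (by decide)) (iff_of_false hB (by decide))
      (iff_of_true h11 rfl) (iff_of_false nI (by decide)) (iff_of_false n01 (by decide)), h11.1, h11.2]
    exact tcert_le_o11 a c n
  by_cases hI : isImg2 ρ β D y
  · have hl := lab_img2 ρ β D hI
    have n01 : ¬ is01 ρ β y := fun h => by unfold is01 at h; omega
    rw [t2cert_coe_eq ρ β D a c y n false false false false false true false (iff_of_false hT (by decide))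
      (iff_of_false h00 (by decide)) (iff_of_false hA (by decide)) (iff_of_false hB (by decide))
      (iff_of_false h11 (by decide)) (iff_of_true hI rfl) (iff_of_false n01 (by decide)), hl.1, hl.2]
    exact tcert_le_img a c n
  by_cases h01 : is01 ρ β y
  · rw [t2cert_coe_eq ρ β D a c y n false false false false false false true (iff_of_false hT (by decide))
      (iff_of_false h00 (by decide)) (iff_of_false hA (by decide)) (iff_of_false hB (by decide))
      (iff_of_false h11 (by decide)) (iff_of_false hI (by decide)) (iff_of_true h01 rfl), h01.1, h01.2]
    exact tcert_le_y01 a c n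
  · rw [t2cert_coe_eq ρ β D a c y n false false false false false false false (iff_of_false hT (by decide))
      (iff_of_false h00 (by decide)) (iff_of_false hA (by decide)) (iff_of_false hB (by decide))
      (iff_of_false h11 (by decide)) (iff_of_false hI (by decide)) (iff_of_false h01 (by decide))]
    apply tcert_le_none
    unfold isTop at hT; unfold is11 at h11; unfold is01 at h01
    omega

omit [Preorder X] [Fintype X] in
/-- **the pointwise certificate** -/
lemma t2cert_le (z : X × Y) (m : ℕ∞) :
    t2certS ρ β D (r z.1) (b z.1) z.2 m + t2certC ρ β D (r z.1) (b z.1) z.2 m ≤ uw (tR r ρ) (tB b β) z m := by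
  induction m using ENat.recTopCoe with
  | top => rw [t2cert_top, tuw_top]
  | coe n => rw [tuw_coe]; exact t2cert_le_fibre ρ β D (r z.1) (b z.1) z.2 n

end cert

/-! ### the sums -/

section sums

variable (D : ThetaData2 ρ β)

omit [Fintype X] in
/-- the injection lemma for the containment rows: a lower copy of each `P`-fibre is counted at least as often -/
lemma t2sum_rel_ge (P Q : Y → Prop) [DecidablePred P] [DecidablePred Q] (σ : Y → Y)
    (hσ : ∀ y, P y → σ y ≤ y) (hinj : ∀ y y', P y → P y' → σ y = σ y' → y = y')
    (hQ : ∀ y, Q y ↔ ∃ y', P y' ∧ σ y' = y)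
    (φ : X × Y → ℕ∞) (hφ : Monotone φ) (x : X) (m : ℕ∞) :
    ∑ y, indL (P y ∧ φ (x, y) ≤ m) ≤ ∑ y, indL (Q y ∧ φ (x, y) ≤ m) := by
  have hl : ∑ y, indL (P y ∧ φ (x, y) ≤ m) = ∑ y ∈ univ.filter P, indL (φ (x, y) ≤ m) := by
    rw [Finset.sum_filter]
    apply Finset.sum_congr rfl; intro y _
    unfold indL; by_cases h : P y <;> simp [h]
  have hr : ∑ y, indL (Q y ∧ φ (x, y) ≤ m) = ∑ y ∈ univ.filter Q, indL (φ (x, y) ≤ m) := by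
    rw [Finset.sum_filter]
    apply Finset.sum_congr rfl; intro y _
    unfold indL; by_cases h : Q y <;> simp [h]
  have himg : (univ.filter P).image σ = univ.filter Q := by
    ext y; simp only [mem_image, mem_filter, mem_univ, true_and, hQ]
  have hinj' : Set.InjOn σ ↑(univ.filter P) := by
    intro y hy y' hy' he
    simp only [coe_filter, mem_univ, true_and, Set.mem_setOf_eq] at hy hy'
    exact hinj y y' hy hy' he
  rw [hl, hr, ← himg, Finset.sum_image hinj']
  apply Finset.sum_le_sum
  intro y hy
  simp only [mem_filter, mem_univ, true_and] at hy
  exact tindL_mono φ hφ x (hσ y hy) m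

omit [DecidableEq Y] in
/-- a lower-set statement of `X` on the slices of all fibres of a role -/
lemma t2slice_sum_nonneg (P : Y → Prop) [DecidablePred P] (w : X → ℤ)
    (hw : ∀ D : Finset X, IsLowerSet (↑D : Set X) → 0 ≤ ∑ x ∈ D, w x)
    (φ : X × Y → ℕ∞) (hφ : Monotone φ) (m : ℕ∞) :
    0 ≤ ∑ x, ∑ y, (if P y ∧ φ (x, y) ≤ m then w x else 0) := by
  rw [Finset.sum_comm]
  apply Finset.sum_nonneg
  intro y _
  by_cases hy : P y
  · simp only [hy, true_and]
    exact tslice_nonneg w hw φ hφ y m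
  · simp [hy]

/-- the statement part has non-negative total -/
lemma t2sum_certS_nonneg (hG : GDom 1 r b) (hV : VDom 2 r b) (hH : LevelHarris r b)
    (φ : X × Y → ℕ∞) (hφ : Monotone φ) :
    0 ≤ ∑ x, ∑ y, t2certS ρ β D (r x) (b x) y (φ (x, y)) := by
  simp only [t2certS, Finset.sum_add_distrib]
  have h1 : 0 ≤ ∑ x, ∑ y, (if isY00 ρ β D y ∧ φ (x, y) ≤ 1 then gw 1 (r x) (b x) else 0) :=
    t2slice_sum_nonneg (isY00 ρ β D) (fun x => gw 1 (r x) (b x)) hG φ hφ 1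
  have h2 : 0 ≤ ∑ x, ∑ y, (if isYB ρ β D y ∧ φ (x, y) ≤ 2 then vw 2 (r x) (b x) else 0) :=
    t2slice_sum_nonneg (isYB ρ β D) (fun x => vw 2 (r x) (b x)) hV φ hφ 2
  have h3 : 0 ≤ ∑ x, ∑ y, (if is11 ρ β y ∧ φ (x, y) ≤ 1 then hwOne (r x) (b x) else 0) :=
    t2slice_sum_nonneg (is11 ρ β) (fun x => hwOne (r x) (b x)) (sum_hwOne_nonneg r b hH) φ hφ 1
  have h4 : 0 ≤ ∑ x, ∑ y, (if isImg2 ρ β D y ∧ φ (x, y) ≤ 1 then hwOne (r x) (b x) else 0) :=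
    t2slice_sum_nonneg (isImg2 ρ β D) (fun x => hwOne (r x) (b x)) (sum_hwOne_nonneg r b hH) φ hφ 1
  linarith

/-- the containment part has non-negative total -/
lemma t2sum_certC_nonneg (φ : X × Y → ℕ∞) (hφ : Monotone φ) :
    0 ≤ ∑ x, ∑ y, t2certC ρ β D (r x) (b x) y (φ (x, y)) := by
  apply Finset.sum_nonneg
  intro x _
  have e : ∑ y, t2certC ρ β D (r x) (b x) y (φ (x, y))
      = mu1 (r x) (b x) * (∑ y, indL (isY00 ρ β D y ∧ φ (x, y) ≤ 1) - ∑ y, indL (isTop ρ β y ∧ φ (x, y) ≤ 1))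
        + mu2 (r x) (b x) * (∑ y, indL (isYB ρ β D y ∧ φ (x, y) ≤ 2) - ∑ y, indL (isTop ρ β y ∧ φ (x, y) ≤ 2))
        + mu3 (r x) (b x) * (∑ y, indL (isYA ρ β D y ∧ φ (x, y) ≤ 1) - ∑ y, indL (isTop ρ β y ∧ φ (x, y) ≤ 1))
        + mu4 (r x) (b x) * (∑ y, indL (isYA ρ β D y ∧ φ (x, y) ≤ 2) + ∑ y, indL (isYB ρ β D y ∧ φ (x, y) ≤ 2)
            - 2 * ∑ y, indL (isTop ρ β y ∧ φ (x, y) ≤ 2))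
        + mu01 (b x) * (∑ y, indL (isImg2 ρ β D y ∧ φ (x, y) ≤ 1) - ∑ y, indL (is01 ρ β y ∧ φ (x, y) ≤ 1)) := by
    simp only [t2certC, Finset.sum_add_distrib, Finset.sum_sub_distrib, ← Finset.mul_sum]
  rw [e]
  have i1 := t2sum_rel_ge (isTop ρ β) (isY00 ρ β D) D.y00 (fun t ht => (D.h00 t ht.1 ht.2).1)
    (fun t t' ht ht' => D.h00inj t t' ht.1 ht.2 ht'.1 ht'.2) (fun y => Iff.rfl) φ hφ x 1
  have i2 := t2sum_rel_ge (isTop ρ β) (isYB ρ β D) D.yB (fun t ht => (D.hB t ht.1 ht.2).1)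
    (fun t t' ht ht' => D.hBinj t t' ht.1 ht.2 ht'.1 ht'.2) (fun y => Iff.rfl) φ hφ x 2
  have i3 := t2sum_rel_ge (isTop ρ β) (isYA ρ β D) D.yA (fun t ht => (D.hA t ht.1 ht.2).1)
    (fun t t' ht ht' => D.hAinj t t' ht.1 ht.2 ht'.1 ht'.2) (fun y => Iff.rfl) φ hφ x 1
  have i4 := t2sum_rel_ge (isTop ρ β) (isYA ρ β D) D.yA (fun t ht => (D.hA t ht.1 ht.2).1)
    (fun t t' ht ht' => D.hAinj t t' ht.1 ht.2 ht'.1 ht'.2) (fun y => Iff.rfl) φ hφ x 2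
  have i6 := t2sum_rel_ge (is01 ρ β) (isImg2 ρ β D) D.τ (fun y hy => (D.hτ y hy.1 hy.2).1)
    (fun y y' hy hy' => D.hτinj y y' hy.1 hy.2 hy'.1 hy'.2) (fun y => Iff.rfl) φ hφ x 1
  have m1 : 0 ≤ mu1 (r x) (b x) := by unfold mu1; split_ifs <;> norm_num
  have m2 : 0 ≤ mu2 (r x) (b x) := by unfold mu2; split_ifs <;> norm_num
  have m3 : 0 ≤ mu3 (r x) (b x) := by unfold mu3; split_ifs <;> norm_num
  have m4 : 0 ≤ mu4 (r x) (b x) := by unfold mu4; split_ifs <;> norm_num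
  have m5 : 0 ≤ mu01 (b x) := by unfold mu01; split_ifs <;> norm_num
  nlinarith [mul_nonneg m1 (sub_nonneg.2 i1), mul_nonneg m2 (sub_nonneg.2 i2), mul_nonneg m3 (sub_nonneg.2 i3),
    mul_nonneg m4 (sub_nonneg.2 i4), mul_nonneg m4 (sub_nonneg.2 i2), mul_nonneg m5 (sub_nonneg.2 i6)]

/-- **the φ-inequality of `X` in series with a multi-top theta-structured `Y`** -/
theorem phiIneq_theta2 (D : ThetaData2 ρ β) (hG : GDom 1 r b) (hV : VDom 2 r b) (hH : LevelHarris r b) :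
    PhiIneq (tR r ρ) (tB b β) := by
  intro φ hφ
  have hsum : ∑ z, (t2certS ρ β D (r z.1) (b z.1) z.2 (φ z) + t2certC ρ β D (r z.1) (b z.1) z.2 (φ z))
      ≤ ∑ z, uw (tR r ρ) (tB b β) z (φ z) := Finset.sum_le_sum (fun z _ => t2cert_le r b ρ β D z (φ z))
  have hS := t2sum_certS_nonneg r b ρ β D hG hV hH φ hφ
  have hC := t2sum_certC_nonneg r b ρ β D φ hφ
  rw [Finset.sum_add_distrib, Fintype.sum_prod_type, Fintype.sum_prod_type] at hsum
  linarith

/-- **THEOREM**: `X` carrying `G_1`, `V2_2` and the level-1 Harris inequality, in series with any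
multi-top theta-structured `Y`, satisfies the universal level-conditioned Hall statement (UH*). -/
theorem universal_theta2 (D : ThetaData2 ρ β) (hG : GDom 1 r b) (hV : VDom 2 r b) (hH : LevelHarris r b) :
    Universal (tR r ρ) (tB b β) := by
  classical
  exact universal_of_phi (tR r ρ) (tB b β) (phiIneq_theta2 r b ρ β D hG hV hH)

end sums

end Summit.Ventures.PercRepro2.UHClosure
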